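import Mathlib
import Summits.MatrixMultiplication.MatrixMultiplication.Theorems.FidelityWitnessesFidelityGapThreeSeventeenPunctualDefs

/-!
# Borel-fixed border apolarity at `(⟨3,3,3⟩, 17)` — part 11: the torus acts diagonally on monomials

Crux `stmt-MatrixMultiplication-4958` (`FidelityWitnesses.FidelityGapThreeSeventeen`), line
`punctual-saturation`, stub `stub_borelFixedApolarity` (helper file for the Borel normal form half).

For DIAGONAL `P = diag(p)`, `Q = diag(q)`, `R = diag(r)` (the maximal torus of the stabiliser), the
substitution `borelSubst P Q R` of the line's vocabulary rescales every variable,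
`c_{ij} ↦ p_i⁻¹ r_j⁻¹ c_{ij}`, `a_{ij} ↦ p_i q_j a_{ij}`, `b_{ij} ↦ q_i⁻¹ r_j b_{ij}`
(`TorusAct.borelVar_diagonal`), hence acts DIAGONALLY ON MONOMIALS: `x^d ↦ (∏_v scale(v)^{d_v}) x^d`
(`TorusAct.borelSubst_diagonal_monomial`, registered as `stub_borelFixedApolarity_torusAct`).  With
part 9 (a subspace of a piece stable under a diagonal operator is stable under every function of it)
this is the torus part of the passage from infinitesimal to group-level Borel stability
(`IsBorelStable`).  Elementary; everything proved.
-/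

noncomputable section

namespace Summit.MatrixMultiplication.MatrixMultiplication.Theorems.PunctualSaturation

-- single-conjunct summit: the `Summit.<S>.<P>` prefix repeats `MatrixMultiplication` by design (D-0017)
set_option linter.dupNamespace false

open scoped BigOperators
open MvPolynomial

namespace TorusAct

variable (p q r : Fin 3 → ℂ)

/-- The inverse of an entrywise non-zero vector in the product ring is the entrywise inverse. [folklore] -/
theorem ringInverse_pi {n : Type*} [Fintype n] (v : n → ℂ) (hv : ∀ i, v i ≠ 0) :
    Ring.inverse v = fun i => (v i)⁻¹ := by
  have hu : IsUnit v := isUnit_iff_exists_inv.2 ⟨fun i => (v i)⁻¹, funext fun i => by simp [hv i]⟩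
  have h := Ring.mul_inverse_cancel v hu
  funext i
  have hi := congr_fun h i
  simp only [Pi.mul_apply, Pi.one_apply] at hi
  exact (eq_inv_of_mul_eq_one_right hi)

/-- The scaling factor of the variable `v` under the torus element `(diag p, diag q, diag r)`. Written
`tsc[p, q, r]`. [folklore] -/
local notation3 "tsc[" p ", " q ", " r "]" => fun (v : Var) =>
  ![((p : Fin 3 → ℂ) v.2.1)⁻¹ * ((r : Fin 3 → ℂ) v.2.2)⁻¹, (p : Fin 3 → ℂ) v.2.1 * (q : Fin 3 → ℂ) v.2.2,
    ((q : Fin 3 → ℂ) v.2.1)⁻¹ * (r : Fin 3 → ℂ) v.2.2] v.1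

/-- **The torus rescales the variables**: `c_{ij} ↦ p_i⁻¹ r_j⁻¹ c_{ij}`, `a_{ij} ↦ p_i q_j a_{ij}`,
`b_{ij} ↦ q_i⁻¹ r_j b_{ij}`. [folklore] -/
theorem borelVar_diagonal (hp : ∀ i, p i ≠ 0) (hq : ∀ i, q i ≠ 0) (hr : ∀ i, r i ≠ 0) (v : Var) :
    borelVar (Matrix.diagonal p) (Matrix.diagonal q) (Matrix.diagonal r) v = C (tsc[p, q, r] v) * X v := by
  -- inverses of the invertible diagonal matrices (cf. `NoSat.inv_diagonal_eq` of the stub-N file)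
  have hinv : ∀ w : Fin 3 → ℂ, (∀ i, w i ≠ 0) →
      (Matrix.diagonal w)⁻¹ = Matrix.diagonal fun i => (w i)⁻¹ := fun w hw => by
    rw [Matrix.inv_diagonal, ringInverse_pi w hw]
  obtain ⟨s, i, j⟩ := v
  have key : ∀ (A B : Fin 3 → ℂ) (s₀ : Fin 3),
      ∑ i', ∑ j', C (Matrix.diagonal A i i' * Matrix.diagonal B j' j) * X (s₀, i', j') =
        C (A i * B j) * (X (s₀, i, j) : S) := by
    intro A B s₀
    rw [Finset.sum_eq_single i, Finset.sum_eq_single j]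
    · rw [Matrix.diagonal_apply_eq, Matrix.diagonal_apply_eq]
    · intro j' _ hj'
      rw [Matrix.diagonal_apply_ne _ hj', mul_zero, C_0, zero_mul]
    · intro h; exact absurd (Finset.mem_univ j) h
    · intro i' _ hi'
      refine Finset.sum_eq_zero fun j' _ => ?_
      rw [Matrix.diagonal_apply_ne _ (Ne.symm hi'), zero_mul, C_0, zero_mul]
    · intro h; exact absurd (Finset.mem_univ i) h
  have key' : ∀ (A B : Fin 3 → ℂ) (s₀ : Fin 3),
      ∑ i', ∑ j', C (Matrix.diagonal A i' i * Matrix.diagonal B j j') * X (s₀, i', j') =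
        C (A i * B j) * (X (s₀, i, j) : S) := by
    intro A B s₀
    rw [← key A B s₀]
    refine Finset.sum_congr rfl fun i' _ => Finset.sum_congr rfl fun j' _ => ?_
    rw [Matrix.diagonal_apply, Matrix.diagonal_apply, Matrix.diagonal_apply, Matrix.diagonal_apply]
    by_cases h1 : i = i' <;> by_cases h2 : j = j' <;> simp [h1, h2, Ne.symm]
  fin_cases s
  · simp only [borelVar, Fin.zero_eta, Fin.isValue, Matrix.cons_val_zero,
      hinv p hp, hinv r hr]
    exact key' _ _ 0
  · simp only [borelVar, Fin.mk_one, Fin.isValue, Matrix.cons_val_one, Matrix.cons_val_zero]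
    exact key _ _ 1
  · simp only [borelVar, Fin.reduceFinMk, Fin.isValue, Matrix.cons_val, hinv q hq]
    exact key _ _ 2

/-- **The torus acts diagonally on monomials**: `x^d ↦ (∏_v scale(v)^{d_v}) · x^d`. [folklore] -/
theorem borelSubst_diagonal_monomial (hp : ∀ i, p i ≠ 0) (hq : ∀ i, q i ≠ 0) (hr : ∀ i, r i ≠ 0)
    (d : Var →₀ ℕ) (a : ℂ) :
    borelSubst (Matrix.diagonal p) (Matrix.diagonal q) (Matrix.diagonal r) (monomial d a) =
      (d.prod fun v e => (tsc[p, q, r] v) ^ e) • monomial d a := by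
  have hvar : borelVar (Matrix.diagonal p) (Matrix.diagonal q) (Matrix.diagonal r) =
      fun v => C (tsc[p, q, r] v) * X v := funext fun v => borelVar_diagonal p q r hp hq hr v
  rw [borelSubst, hvar, aeval_monomial, algebraMap_eq]
  have hsplit : (d.prod fun v e => (C (tsc[p, q, r] v) * X v : S) ^ e) =
      C (d.prod fun v e => (tsc[p, q, r] v) ^ e) * d.prod fun v e => (X v : S) ^ e := by
    simp only [Finsupp.prod, mul_pow, Finset.prod_mul_distrib, map_prod, map_pow]
  rw [hsplit, ← mul_assoc, ← map_mul, mul_comm a, map_mul, mul_assoc, ← monomial_eq, smul_eq_C_mul]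

end TorusAct

/-- **Registered sub-goal `stub_borelFixedApolarity_torusAct` of `stub_borelFixedApolarity`**: the torus of the
stabiliser acts diagonally on monomials of the Cox ring. [folklore] -/
theorem stub_borelFixedApolarity_torusAct :
    ∀ (p q r : Fin 3 → ℂ), (∀ i, p i ≠ 0) → (∀ i, q i ≠ 0) → (∀ i, r i ≠ 0) →
      ∀ (d : Var →₀ ℕ) (a : ℂ),
        borelSubst (Matrix.diagonal p) (Matrix.diagonal q) (Matrix.diagonal r) (MvPolynomial.monomial d a) =
          (d.prod fun v e => (![(p v.2.1)⁻¹ * (r v.2.2)⁻¹, p v.2.1 * q v.2.2, (q v.2.1)⁻¹ * r v.2.2] v.1) ^ e) •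
            MvPolynomial.monomial d a :=
  fun p q r hp hq hr d a => TorusAct.borelSubst_diagonal_monomial p q r hp hq hr d a

end Summit.MatrixMultiplication.MatrixMultiplication.Theorems.PunctualSaturation

end
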